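/-
Copyright: derived here (Resolution Observatory cell `pub-rosobs`, carver gen 50). AI-written Lean; AI review is
weaker than expert review.  Companion file of the cell's POLYNOMIAL weighted-centre model `W(f)`; statements OURS: the
BOOTSTRAP LEMMA (engine 1 gen 33, THEOREM-LC-eng1-g33 §6) and the BOOTSTRAP⁺ LEMMA (engine 1 gen 34,
THEOREM-FQ-eng1-g34 §7) of the toy model, typed as PURE LOGIC over an abstract interface ("system frame") whose fields
are exactly the identity-level inputs the induction consumes (CARVER-NOTES-eng1-g33 T12, CARVER-NOTES-eng1-g34 T15).
Instrument — NOT a resolution theorem, NOT a statement about the invariant of [AbramovichTemkinWlodarczyk2024] on power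
series, NOT summit progress.  No algebra is done here: the algebraic inputs (T9 ABSORBER THEOREM, LEMMA Γ, ND0, (KILL))
enter as named hypotheses (`SystemFrame.Laws`, `SystemFrame.LawsPlus`).  The citation tags below are CONTEXT cites
(the objects abstracted are graded automorphisms of the graded algebra of a weighted centre fixing the initial form,
[ATW24, Thm. 5.3.1 (2)–(3)]); the induction and every statement are the cell's, elementary.
-/
import Mathlib.Algebra.Order.Field.Rat
import Mathlib.Data.Set.Finite.Lemmas
import Mathlib.Order.Interval.Set.Defs
import Mathlib.Tactic.Linarith
import Mathlib.Tactic.Positivity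
import HarnessLib

/-!
# The bootstrap induction of the W(f) toy model, as pure logic

## The model being abstracted (THEOREM-LC-eng1-g33 §6, THEOREM-FQ-eng1-g34 §1, §7)

A *configuration* is a triple `(N, w, g)`: a finite slot set `N` with weights `w_i ∈ (0, 1/2]` and a
quasi-homogeneous `g ∈ k[ε_N]` of value `1`.  A *non-trivial graded isotropy* of `(N, g)` is a graded
`k[σ']`-algebra automorphism `Φ ≠ id` of `k[σ'][ε_N]` (`deg σ' = ρ' > 0`) with `g ∘ Φ = g`; it may have PURE terms
(`b·σ'^j` with no `ε`), the lightest of which has exponent `j*` and weight `w* = j*·ρ'`; it may be of CUBIC ORDER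
(`Φ ≡ id mod σ'^3`).  Hypothesis (P) with threshold `η` is a property of the CONFIGURATION alone (every slot of
weight `> η` is pinned in every graded coordinate system); a (P)-SYSTEM is a configuration with (P) (threshold `η`)
together with a non-trivial graded isotropy of degree `ρ > η`.

## The abstraction

`SystemFrame` records: configurations `Conf` with a size `size C = |N|`, the type `Iso C` of NON-TRIVIAL graded
isotropies of `C` (of any degree), and for each isotropy its degree `deg`, the predicates `HasPure`, `CubicOrder`,
the lightest pure exponent `lightExp` (junk unless `HasPure`), the predicate `Pinned η C` (= (P) with threshold
`η`) and the predicate `R0` of THEOREM-FQ §7.  `SystemFrame.Laws` are the three inputs of the plain bootstrap: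

* `three_le_lightExp_of_cubicOrder` : a cubic-order isotropy with a pure term has `j* ≥ 3` (definitional in the model);
* `absorber` : T9's ABSORBER THEOREM ((BASE)/(KILL)/(LIGHT)): a purely impure (P)-system yields a (P)-system (same
  threshold) on FEWER slots, of degree `≥` its degree (T9 also gives it a pure term — not consumed by the induction);
* `gammaStep` : LEMMA Γ + ND0 (`p` odd), in contrapositive form: a (P)-system whose lightest pure term is `c·σ²`
  produces a NON-TRIVIAL cubic-order isotropy of the same configuration and degree (namely `Γ_σ^p` or
  `Γ_σ^{p-1} ∘ Γ_{-σ}` — if both were the identity, the `u := σ²` re-parametrised even isotropy would shift a slot of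
  weight `deg u`, which ND0 forbids; identity-level parts typed in `Literature/…/WeightedCentreUnipotentIsotropy`,
  `…IsotropyTwist`, `…GammaCongruences`, `…EvenReparam`).

`SystemFrame.LawsPlus` adds the inputs of BOOTSTRAP⁺: `reduce_or_R0` ((KILL) applied to the slots lighter than the
least shifted weight: either (R0) holds or there is a (P)-system of the same degree on fewer slots), and two
finiteness facts (`finite_deg`: above any `δ > 0` only finitely many degrees carry an isotropy with a pure term —
in the model these degrees are `w_i / j`; `finite_lightExp`: at a fixed degree only finitely many values of `j*` —
in the model `j* = w*/ρ` with `w*` a slot weight).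

## Results

* `SystemFrame.bootstrap` : under `Laws`, if `PURE ρ` holds for every `ρ` in an up-set `U ⊆ ℚ`, then no (P)-system
  has degree in `U`; corollaries `bootstrap_Ioi` (`U = (ρ₁, ∞)`, THEOREM-LC §6 verbatim) and `bootstrap_Ici`.
* `SystemFrame.bootstrapPlus` : under `LawsPlus`, the same with `PURE` weakened to `PUREplus` — the pure-side
  statement may ASSUME (H1), (H>), (Hmax), (R0) (THEOREM-FQ §7); corollaries `bootstrapPlus_Ioi`, `bootstrapPlus_Ici`
  (these need `0 < ρ₁`, which holds in the cell: `ρ₁ ≥ 1/q`).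
* `SystemFrame.PUREplus_of_PURE` : `PURE ρ → PUREplus ρ` (THEOREM-FQ §7 Remark (a)).

Where `p` odd enters: only inside `gammaStep` (`2c ≠ 0`).  Nothing here mentions `k`, `p`, `q`, weights or
polynomials: instantiating the frame by the W(f) model is a separate task (the laws are the cell's T9 ABSORBER THEOREM,
LEMMA Γ, ND0 and (KILL), none of which is typed as of gen 50; the identity-level parts of LEMMA Γ are the companion
files `WeightedCentreUnipotentIsotropy`, `WeightedCentreIsotropyTwist`, `WeightedCentreGammaCongruences`,
`WeightedCentreEvenReparam`).

[ATW24] Abramovich–Temkin–Włodarczyk, *Functorial embedded resolution via weighted blowings up*, Algebra & Number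
Theory 18 (2024), Thm. 5.3.1 (2)–(3) (p. 1578: `inv = max` over admissible centres; the centre is unique, so two
presentations differ by a graded automorphism of its graded algebra — the "isotropies" of the cell's model, cf.
`WeightedCentreGradedAutomorphism`).  CONTEXT ONLY; nothing in this file is a statement of [ATW24].
-/

namespace Literature.AlgebraicGeometry.Resolution.WeightedBlowup

universe u

/-- The abstract interface of the bootstrap: configurations, their non-trivial graded isotropies, and the
attributes the induction reads (cell pub-rosobs, statements ours; THEOREM-LC-eng1-g33 §6, THEOREM-FQ-eng1-g34 §7).
[cite: AbramovichTemkinWlodarczyk2024, Thm. 5.3.1 (2)–(3) (p. 1578)] -/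
structure SystemFrame : Type (u + 1) where
  /-- configurations `(N, w, g)` -/
  Conf : Type u
  /-- NON-TRIVIAL graded isotropies of the configuration over a one-parameter ring, of any degree -/
  Iso : Conf → Type u
  /-- number of slots `|N|` -/
  size : Conf → ℕ
  /-- degree `ρ' = deg σ'` of the parameter -/
  deg : ∀ {C : Conf}, Iso C → ℚ
  /-- the isotropy has a pure term -/
  HasPure : ∀ {C : Conf}, Iso C → Prop
  /-- `j*`, the `σ'`-exponent of the lightest pure term (unspecified when there is no pure term) -/
  lightExp : ∀ {C : Conf}, Iso C → ℕ
  /-- the isotropy is `≡ id (mod σ'^3)` -/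
  CubicOrder : ∀ {C : Conf}, Iso C → Prop
  /-- hypothesis (P) with threshold `η` — a property of the configuration alone -/
  Pinned : ℚ → Conf → Prop
  /-- (R0) of THEOREM-FQ §7: every slot weighs `≥ w*` and the class `w*` carries no impure shift -/
  R0 : ∀ {C : Conf}, Iso C → Prop

namespace SystemFrame

variable (F : SystemFrame.{u})

/-- A (P)-system: (P) with threshold `η` on the configuration and a non-trivial isotropy of degree `> η`
(T9 §2 / THEOREM-FQ §1; ours).
[cite: AbramovichTemkinWlodarczyk2024, Thm. 5.3.1 (2)–(3) (p. 1578)] -/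
def PSystem (η : ℚ) {C : F.Conf} (X : F.Iso C) : Prop := F.Pinned η C ∧ η < F.deg X

/-- `PURE ρ` (THEOREM-LC §6 DEFINITION; ours): every (P)-system of degree `ρ` with a pure term has `j* = 2`.
[cite: AbramovichTemkinWlodarczyk2024, Thm. 5.3.1 (2)–(3) (p. 1578)] -/
def PURE (ρ : ℚ) : Prop :=
  ∀ (η : ℚ) (C : F.Conf) (X : F.Iso C), F.PSystem η X → F.deg X = ρ → F.HasPure X → F.lightExp X = 2

/-- (H1) at `ρ` (THEOREM-FQ §7): every non-trivial isotropy of `C` of degree `≥ ρ` has a pure term.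
[cite: AbramovichTemkinWlodarczyk2024, Thm. 5.3.1 (2)–(3) (p. 1578)] -/
def H1 (C : F.Conf) (ρ : ℚ) : Prop := ∀ Y : F.Iso C, ρ ≤ F.deg Y → F.HasPure Y

/-- (H>) at `ρ` (THEOREM-FQ §7): `C` has no non-trivial isotropy of degree `> ρ`.
[cite: AbramovichTemkinWlodarczyk2024, Thm. 5.3.1 (2)–(3) (p. 1578)] -/
def Hgt (C : F.Conf) (ρ : ℚ) : Prop := ∀ Y : F.Iso C, F.deg Y ≤ ρ

/-- (Hmax) for `X` (THEOREM-FQ §7): every non-trivial isotropy of the same degree has a pure term of weight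
`≤ w*(X)`; since pure weights at a fixed degree `ρ` are `j*·ρ`, this reads `j*(Y) ≤ j*(X)`.
[cite: AbramovichTemkinWlodarczyk2024, Thm. 5.3.1 (2)–(3) (p. 1578)] -/
def Hmax {C : F.Conf} (X : F.Iso C) : Prop :=
  ∀ Y : F.Iso C, F.deg Y = F.deg X → F.HasPure Y ∧ F.lightExp Y ≤ F.lightExp X

/-- `PUREplus ρ` (THEOREM-FQ §7 DEFINITION (PURE⁺); ours): every (P)-system of degree `ρ` with a pure term that
satisfies (H1), (H>), (Hmax), (R0) has `j* = 2`.
[cite: AbramovichTemkinWlodarczyk2024, Thm. 5.3.1 (2)–(3) (p. 1578)] -/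
def PUREplus (ρ : ℚ) : Prop :=
  ∀ (η : ℚ) (C : F.Conf) (X : F.Iso C), F.PSystem η X → F.deg X = ρ → F.HasPure X →
    F.H1 C ρ → F.Hgt C ρ → F.Hmax X → F.R0 X → F.lightExp X = 2

variable {F}

/-- `PURE ρ ⇒ PURE⁺ ρ` (THEOREM-FQ §7 Remark (a); ours).
[cite: AbramovichTemkinWlodarczyk2024, Thm. 5.3.1 (2)–(3) (p. 1578)] -/
theorem PUREplus_of_PURE {ρ : ℚ} (h : F.PURE ρ) : F.PUREplus ρ :=
  fun η C X hX hρ hp _ _ _ _ => h η C X hX hρ hp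

/-- A (P)-system stays a (P)-system when the isotropy is replaced by one of the same configuration and of
degree at least as large ((P) does not mention the isotropy; ours).
[cite: AbramovichTemkinWlodarczyk2024, Thm. 5.3.1 (2)–(3) (p. 1578)] -/
theorem PSystem.of_le {η : ℚ} {C : F.Conf} {X Y : F.Iso C} (hX : F.PSystem η X) (h : F.deg X ≤ F.deg Y) :
    F.PSystem η Y :=
  ⟨hX.1, lt_of_lt_of_le hX.2 h⟩

variable (F)

/-- The three inputs of the plain bootstrap (THEOREM-LC §6 "[Inputs …]"; ours).  In the model:
`three_le_lightExp_of_cubicOrder` is definitional; `absorber` is T9's ABSORBER THEOREM; `gammaStep` is LEMMA Γ's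
computation with ND0, `p` odd (the only place the characteristic enters).
[cite: AbramovichTemkinWlodarczyk2024, Thm. 5.3.1 (2)–(3) (p. 1578)] -/
structure Laws : Prop where
  /-- `Φ ≡ id (mod σ³)` with a pure term ⇒ its lightest pure exponent is `≥ 3`. -/
  three_le_lightExp_of_cubicOrder :
    ∀ {C : F.Conf} (X : F.Iso C), F.CubicOrder X → F.HasPure X → 3 ≤ F.lightExp X
  /-- ABSORBER THEOREM: a purely impure (P)-system yields a (P)-system on fewer slots, of degree `≥` its degree
  (same threshold).  (T9's theorem also provides a pure term of the new isotropy; the induction never uses it, so it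
  is not demanded here.) -/
  absorber : ∀ (η : ℚ) {C : F.Conf} (X : F.Iso C), F.PSystem η X → ¬ F.HasPure X →
    ∃ (C' : F.Conf) (X' : F.Iso C'), F.size C' < F.size C ∧ F.PSystem η X' ∧ F.deg X ≤ F.deg X'
  /-- LEMMA Γ + ND0, contrapositive: a (P)-system with lightest pure term `c·σ²` produces a non-trivial
  cubic-order isotropy of the same configuration and degree. -/
  gammaStep : ∀ (η : ℚ) {C : F.Conf} (X : F.Iso C), F.PSystem η X → F.HasPure X → F.lightExp X = 2 →
    ∃ Y : F.Iso C, F.deg Y = F.deg X ∧ F.CubicOrder Y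

/-- The inputs of BOOTSTRAP⁺ (THEOREM-FQ §7; ours): the plain laws, (KILL) in the form "either (R0) or a
(P)-system of the same degree on fewer slots", and two finiteness facts of the model (degrees carrying a pure term
are `w_i / j`; `j* = w*/ρ` with `w*` a slot weight).
[cite: AbramovichTemkinWlodarczyk2024, Thm. 5.3.1 (2)–(3) (p. 1578)] -/
structure LawsPlus : Prop extends Laws F where
  /-- (KILL) on the slots lighter than the least shifted weight: (R0), or a smaller (P)-system of the same degree. -/
  reduce_or_R0 : ∀ (η : ℚ) {C : F.Conf} (X : F.Iso C), F.PSystem η X → F.HasPure X →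
    F.R0 X ∨ ∃ (C' : F.Conf) (X' : F.Iso C'), F.size C' < F.size C ∧ F.PSystem η X' ∧ F.deg X' = F.deg X
  /-- Above any `δ > 0`, finitely many degrees carry a non-trivial isotropy with a pure term. -/
  finite_deg : ∀ (C : F.Conf) (δ : ℚ), 0 < δ →
    Set.Finite {ρ : ℚ | δ < ρ ∧ ∃ Y : F.Iso C, F.HasPure Y ∧ F.deg Y = ρ}
  /-- At a fixed degree, finitely many values of `j*`. -/
  finite_lightExp : ∀ (C : F.Conf) (ρ : ℚ),
    Set.Finite {j : ℕ | ∃ Y : F.Iso C, F.deg Y = ρ ∧ F.HasPure Y ∧ F.lightExp Y = j}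

variable {F}

/-! ## The plain bootstrap (THEOREM-LC-eng1-g33 §6) -/

/-- **BOOTSTRAP LEMMA**, up-set form (THEOREM-LC-eng1-g33 §6; ours).  If `PURE ρ` holds for every `ρ` in an
up-set `U`, then no (P)-system has degree in `U`.  Proof = the four-line induction on `|N|` of loc. cit.:
(1) `O_ρ` — a non-trivial cubic-order isotropy of degree `ρ` either has a pure term (`j* ≥ 3`, contradicting
`PURE ρ`) or is purely impure (ABSORBER ⇒ smaller (P)-system of degree `≥ ρ`, contradicting the induction
hypothesis); (2)+(3) a pure term forces `j* = 2` by `PURE ρ`, and then `gammaStep` contradicts `O_ρ`;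
(4) no pure term ⇒ ABSORBER ⇒ induction hypothesis.
[cite: AbramovichTemkinWlodarczyk2024, Thm. 5.3.1 (2)–(3) (p. 1578)] -/
theorem bootstrap (L : F.Laws) (U : Set ℚ) (hU : ∀ ⦃a b : ℚ⦄, a ∈ U → a ≤ b → b ∈ U)
    (hP : ∀ ρ ∈ U, F.PURE ρ) :
    ∀ (η : ℚ) (C : F.Conf) (X : F.Iso C), F.PSystem η X → F.deg X ∉ U := by
  suffices h : ∀ (n : ℕ) (C : F.Conf), F.size C = n →
      ∀ (η : ℚ) (X : F.Iso C), F.PSystem η X → F.deg X ∉ U from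
    fun η C X hX => h _ C rfl η X hX
  intro n
  induction n using Nat.strong_induction_on with
  | _ n ih =>
    intro C hC η X hX hdeg
    -- (1) O_ρ : the configuration has no non-trivial cubic-order isotropy of degree ρ = deg X
    have hO : ∀ Y : F.Iso C, F.deg Y = F.deg X → ¬ F.CubicOrder Y := by
      intro Y hY hcub
      have hYsys : F.PSystem η Y := hX.of_le (le_of_eq hY.symm)
      by_cases hp : F.HasPure Y
      · have h3 := L.three_le_lightExp_of_cubicOrder Y hcub hp
        have h2 := hP _ (hY ▸ hdeg) η C Y hYsys rfl hp
        omega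
      · obtain ⟨C', X', hlt, hsys', hle⟩ := L.absorber η Y hYsys hp
        exact ih _ (hC ▸ hlt) C' rfl η X' hsys' (hU (hY ▸ hdeg) hle)
    by_cases hp : F.HasPure X
    · -- (2)+(3) PURE ρ ⇒ j* = 2 ⇒ Γ-step ⇒ a cubic-order isotropy, excluded by (1)
      obtain ⟨Y, hY, hcub⟩ := L.gammaStep η X hX hp (hP _ hdeg η C X hX rfl hp)
      exact hO Y hY hcub
    · -- (4) purely impure ⇒ ABSORBER ⇒ induction hypothesis
      obtain ⟨C', X', hlt, hsys', hle⟩ := L.absorber η X hX hp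
      exact ih _ (hC ▸ hlt) C' rfl η X' hsys' (hU hdeg hle)

/-- **BOOTSTRAP LEMMA**, open ray (THEOREM-LC-eng1-g33 §6 verbatim; ours): if `PURE ρ` for every `ρ > ρ₁`, then no
(P)-system has degree `> ρ₁`.
[cite: AbramovichTemkinWlodarczyk2024, Thm. 5.3.1 (2)–(3) (p. 1578)] -/
theorem bootstrap_Ioi (L : F.Laws) {ρ₁ : ℚ} (hP : ∀ ρ, ρ₁ < ρ → F.PURE ρ)
    (η : ℚ) (C : F.Conf) (X : F.Iso C) (hX : F.PSystem η X) : ¬ ρ₁ < F.deg X :=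
  bootstrap L (Set.Ioi ρ₁) (fun _ _ ha hab => lt_of_lt_of_le ha hab) (fun ρ hρ => hP ρ hρ) η C X hX

/-- **BOOTSTRAP LEMMA**, closed ray (ours): if `PURE ρ` for every `ρ ≥ ρ₁`, then no (P)-system has degree `≥ ρ₁`.
[cite: AbramovichTemkinWlodarczyk2024, Thm. 5.3.1 (2)–(3) (p. 1578)] -/
theorem bootstrap_Ici (L : F.Laws) {ρ₁ : ℚ} (hP : ∀ ρ, ρ₁ ≤ ρ → F.PURE ρ)
    (η : ℚ) (C : F.Conf) (X : F.Iso C) (hX : F.PSystem η X) : ¬ ρ₁ ≤ F.deg X :=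
  bootstrap L (Set.Ici ρ₁) (fun _ _ ha hab => le_trans ha hab) (fun ρ hρ => hP ρ hρ) η C X hX

/-- COROLLARY I(ix) shape (THEOREM-LC §6; ours): a configuration with (P) (threshold `η`) admits no non-trivial
graded isotropy of any degree `ρ > max η ρ₁` when `PURE` holds above `ρ₁`.
[cite: AbramovichTemkinWlodarczyk2024, Thm. 5.3.1 (2)–(3) (p. 1578)] -/
theorem no_iso_of_pinned (L : F.Laws) {ρ₁ η : ℚ} (hP : ∀ ρ, ρ₁ < ρ → F.PURE ρ) {C : F.Conf}
    (hC : F.Pinned η C) (X : F.Iso C) (hη : η < F.deg X) : F.deg X ≤ ρ₁ :=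
  le_of_not_gt (bootstrap_Ioi L hP η C X ⟨hC, hη⟩)

/-! ## The strong bootstrap (THEOREM-FQ-eng1-g34 §7) -/

/-- **BOOTSTRAP⁺ LEMMA**, up-set form (THEOREM-FQ-eng1-g34 §7; ours).  If `PUREplus ρ` holds for every `ρ` in an
up-set `U` bounded away from `0`, then no (P)-system has degree in `U`.  Proof = loc. cit.: by induction on `|N|`;
on a configuration carrying a (P)-system with degree in `U`, (H1) holds at every degree in `U` above the threshold
(ABSORBER + induction hypothesis); the degrees in `U` carrying an isotropy are then finitely many (`finite_deg`), let
`ρ` be the largest — (H>) —, and among the isotropies of degree `ρ` pick `Φ` with `j*` maximal (`finite_lightExp`)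
— (Hmax) —; `reduce_or_R0` gives (R0) (the alternative is a smaller (P)-system of degree `ρ ∈ U`); so
`PUREplus ρ` yields `j*(Φ) = 2`, `gammaStep` a non-trivial cubic-order isotropy `Y` of degree `ρ`, which by (H1)
has a pure term with `j*(Y) ≥ 3 > 2 = j*(Φ)`, contradicting (Hmax).
[cite: AbramovichTemkinWlodarczyk2024, Thm. 5.3.1 (2)–(3) (p. 1578)] -/
theorem bootstrapPlus (L : F.LawsPlus) (U : Set ℚ) (hU : ∀ ⦃a b : ℚ⦄, a ∈ U → a ≤ b → b ∈ U)
    (hU0 : ∃ δ : ℚ, 0 < δ ∧ ∀ ρ ∈ U, δ < ρ) (hP : ∀ ρ ∈ U, F.PUREplus ρ) :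
    ∀ (η : ℚ) (C : F.Conf) (X : F.Iso C), F.PSystem η X → F.deg X ∉ U := by
  obtain ⟨δ, hδ, hUδ⟩ := hU0
  suffices h : ∀ (n : ℕ) (C : F.Conf), F.size C = n →
      ∀ (η : ℚ) (X : F.Iso C), F.PSystem η X → F.deg X ∉ U from
    fun η C X hX => h _ C rfl η X hX
  intro n
  induction n using Nat.strong_induction_on with
  | _ n ih =>
    intro C hC η X₀ hX₀ hdeg₀
    -- (a) every (P)-system on C (threshold η) with degree in U has a pure term
    have hpure : ∀ Y : F.Iso C, η < F.deg Y → F.deg Y ∈ U → F.HasPure Y := by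
      intro Y hηY hYU
      by_contra hp
      obtain ⟨C', X', hlt, hsys', hle⟩ := L.absorber η Y ⟨hX₀.1, hηY⟩ hp
      exact ih _ (hC ▸ hlt) C' rfl η X' hsys' (hU hYU hle)
    -- (b) the degrees in U above η carrying an isotropy: finite and nonempty; ρ := the largest
    set D : Set ℚ := {ρ : ℚ | ρ ∈ U ∧ η < ρ ∧ ∃ Y : F.Iso C, F.deg Y = ρ} with hD
    have hDfin : D.Finite := by
      refine (L.finite_deg C δ hδ).subset ?_
      rintro ρ ⟨hρU, hηρ, Y, rfl⟩
      exact ⟨hUδ _ hρU, Y, hpure Y hηρ hρU, rfl⟩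
    have hDne : D.Nonempty := ⟨F.deg X₀, hdeg₀, hX₀.2, X₀, rfl⟩
    obtain ⟨ρ, hρD, hρmax⟩ := Set.exists_max_image D id hDfin hDne
    obtain ⟨hρU, hηρ, Y₁, hY₁⟩ := hρD
    -- (c) (H1) at ρ and (d) (H>) at ρ
    have hH1 : F.H1 C ρ := fun Y hY => hpure Y (lt_of_lt_of_le hηρ hY) (hU hρU hY)
    have hHgt : F.Hgt C ρ := by
      intro Y
      by_contra hle
      have hlt : ρ < F.deg Y := lt_of_not_ge hle
      have hYD : F.deg Y ∈ D := ⟨hU hρU hlt.le, lt_trans hηρ hlt, Y, rfl⟩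
      exact absurd (hρmax _ hYD) (not_le.mpr hlt)
    -- (e) among the isotropies of degree ρ choose Φ with j* maximal: (Hmax)
    set J : Set ℕ := {j : ℕ | ∃ Y : F.Iso C, F.deg Y = ρ ∧ F.HasPure Y ∧ F.lightExp Y = j} with hJ
    have hJfin : J.Finite := L.finite_lightExp C ρ
    have hJne : J.Nonempty := ⟨F.lightExp Y₁, Y₁, hY₁, hH1 Y₁ (le_of_eq hY₁.symm), rfl⟩
    obtain ⟨j₀, hj₀J, hj₀max⟩ := Set.exists_max_image J id hJfin hJne
    obtain ⟨Φ, hΦdeg, hΦpure, hΦj⟩ := hj₀J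
    have hHmax : F.Hmax Φ := by
      intro Y hY
      rw [hΦdeg] at hY
      refine ⟨hH1 Y (le_of_eq hY.symm), ?_⟩
      rw [hΦj]
      exact hj₀max _ ⟨Y, hY, hH1 Y (le_of_eq hY.symm), rfl⟩
    -- (f) Φ is a (P)-system; (KILL) gives (R0) (the alternative contradicts the induction hypothesis)
    have hΦsys : F.PSystem η Φ := ⟨hX₀.1, hΦdeg ▸ hηρ⟩
    have hR0 : F.R0 Φ := by
      rcases L.reduce_or_R0 η Φ hΦsys hΦpure with h | ⟨C', X', hlt, hsys', heq⟩
      · exact h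
      · exact absurd (heq.trans hΦdeg ▸ hρU : F.deg X' ∈ U) (ih _ (hC ▸ hlt) C' rfl η X' hsys')
    -- (g) PURE⁺ ρ ⇒ j*(Φ) = 2 ; (h) Γ-step ⇒ cubic-order Y of degree ρ with j*(Y) ≥ 3, contradicting (Hmax)
    have h2 : F.lightExp Φ = 2 := hP ρ hρU η C Φ hΦsys hΦdeg hΦpure hH1 hHgt hHmax hR0
    obtain ⟨Y, hY, hcub⟩ := L.gammaStep η Φ hΦsys hΦpure h2
    obtain ⟨hYpure, hYle⟩ := hHmax Y hY
    have h3 := L.three_le_lightExp_of_cubicOrder Y hcub hYpure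
    omega

/-- **BOOTSTRAP⁺ LEMMA**, open ray (THEOREM-FQ-eng1-g34 §7 verbatim; ours): `0 < ρ₁` and `PUREplus ρ` for every
`ρ > ρ₁` ⇒ no (P)-system has degree `> ρ₁`.
[cite: AbramovichTemkinWlodarczyk2024, Thm. 5.3.1 (2)–(3) (p. 1578)] -/
theorem bootstrapPlus_Ioi (L : F.LawsPlus) {ρ₁ : ℚ} (hρ₁ : 0 < ρ₁) (hP : ∀ ρ, ρ₁ < ρ → F.PUREplus ρ)
    (η : ℚ) (C : F.Conf) (X : F.Iso C) (hX : F.PSystem η X) : ¬ ρ₁ < F.deg X :=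
  bootstrapPlus L (Set.Ioi ρ₁) (fun _ _ ha hab => lt_of_lt_of_le ha hab) ⟨ρ₁, hρ₁, fun _ h => h⟩
    (fun ρ hρ => hP ρ hρ) η C X hX

/-- **BOOTSTRAP⁺ LEMMA**, closed ray (THEOREM-FQ-eng1-g34 §7 "resp. ≥ ρ₁"; ours): `0 < ρ₁` and `PUREplus ρ` for
every `ρ ≥ ρ₁` ⇒ no (P)-system has degree `≥ ρ₁`.
[cite: AbramovichTemkinWlodarczyk2024, Thm. 5.3.1 (2)–(3) (p. 1578)] -/
theorem bootstrapPlus_Ici (L : F.LawsPlus) {ρ₁ : ℚ} (hρ₁ : 0 < ρ₁) (hP : ∀ ρ, ρ₁ ≤ ρ → F.PUREplus ρ)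
    (η : ℚ) (C : F.Conf) (X : F.Iso C) (hX : F.PSystem η X) : ¬ ρ₁ ≤ F.deg X :=
  bootstrapPlus L (Set.Ici ρ₁) (fun _ _ ha hab => le_trans ha hab)
    ⟨ρ₁ / 2, by positivity, fun ρ h => lt_of_lt_of_le (by linarith) h⟩ (fun ρ hρ => hP ρ hρ) η C X hX

/-- The plain bootstrap is the special case `PURE ⇒ PURE⁺` of the strong one only up to its extra finiteness /
(KILL) laws; conversely every `Laws`-consequence is available under `LawsPlus` (ours, bookkeeping).
[cite: AbramovichTemkinWlodarczyk2024, Thm. 5.3.1 (2)–(3) (p. 1578)] -/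
theorem bootstrap_Ioi_of_lawsPlus (L : F.LawsPlus) {ρ₁ : ℚ} (hP : ∀ ρ, ρ₁ < ρ → F.PURE ρ)
    (η : ℚ) (C : F.Conf) (X : F.Iso C) (hX : F.PSystem η X) : ¬ ρ₁ < F.deg X :=
  bootstrap_Ioi L.toLaws hP η C X hX

end SystemFrame

end Literature.AlgebraicGeometry.Resolution.WeightedBlowup
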